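import Literature.MathematicalPhysics.QuantumLattice.GaugeGroups
import HarnessLib

/-!
# `SU(n)` is a simple compact group: discharge of `isSimpleCompactGroup_specialUnitaryGroup`

Trunk T-QLATTICE. Sibling proof file of
`Literature/MathematicalPhysics/QuantumLattice/GaugeGroups.lean`: it discharges the named fact
`Literature.MathematicalPhysics.QuantumLattice.isSimpleCompactGroup_specialUnitaryGroup` (D-0014) as
`theorem isSimpleCompactGroup_specialUnitaryGroup_holds : isSimpleCompactGroup_specialUnitaryGroup`,
i.e. for a finite index type `n` with `2 ≤ card n` the group `SU(n) = Matrix.specialUnitaryGroup n ℂ`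
is connected, non-abelian, and every closed connected normal subgroup is `⊥` or `⊤`
(`Literature.MathematicalPhysics.QuantumLattice.IsSimpleCompactGroup`).  No statement is introduced or changed here; the
auxiliary declarations below are proof infrastructure (all proved).

## Sources

T. Bröcker, T. tom Dieck, *Representations of Compact Lie Groups*, GTM 98 (1985)
[cite: BrockerTomDieck1985]: I (1.8) (`U(n)`, `SU(n)` as compact matrix groups); IV (1.6) (main
theorem on maximal tori) and IV (3.1) (the diagonal matrices `SΔ(n)` form a maximal torus of
`SU(n)`; every element of `SU(n)` is conjugate *by an element of `SU(n)`* into `SΔ(n)`); IV (3.3)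
(the Weyl group of `SU(n)` is the symmetric group, realised by determinant-one conjugations
permuting the diagonal entries); IV (2.9), proof ("a totally disconnected normal subgroup of a
connected group is always in the center"); V (7.13) and V (8.7) Ex. 6 (semisimple/simple compact
groups: no nontrivial proper connected normal subgroups).  M. Sepanski, *Compact Lie Groups*
(2007) §1.1.4, §1.2.1 [cite: Sepanski2007].  The book does not print "`SU(n)` is simple" as a
numbered item; the proof below is an elementary matrix-group argument assembled from the cited
ingredients, avoiding Lie algebras (which Mathlib does not connect to matrix groups at the pin).

## Proof architecture

* `exists_unitaryGroup_diagonal_of_commute`: a normal complex matrix is unitarily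
  diagonalisable (joint eigenspaces of the commuting Hermitian matrices `A + Aᴴ`, `i(A - Aᴴ)`,
  Mathlib `LinearMap.IsSymmetric.directSum_isInternal_of_commute` +
  `DirectSum.IsInternal.subordinateOrthonormalBasis`); `exists_conj_eq_diagonal`: every
  `x ∈ SU(n)` is `u D u⁻¹` with `u, D ∈ SU(n)`, `D` diagonal (BtD IV (3.1)).
* `dPairHom k l : Circle →* SU(n)`, `w ↦ diag(…, w, …, w⁻¹, …)`; `sSwap a b ∈ SU(n)`, the signed
  transposition, conjugation by which permutes diagonal entries (BtD IV (3.3));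
  `diag_mem_of_dPairHom_mem`: the diagonal torus is generated by the circles `dPairHom k k₀`.
* Connectedness (`connectedSpace_specialUnitaryGroup`): the connected component of `1` is a
  conjugation-invariant subgroup containing all circles, hence the torus, hence everything.
* Non-commutativity (`exists_mul_ne_mul`): `diag(i, -i, 1, …)` and the signed transposition.
* `normal_subgroup_eq_bot_or_eq_top`: for a closed preconnected normal `N ≠ ⊥`, the continuous
  class function `Re tr` maps `N` onto an interval `[t₀, n]` with `t₀ < n`; elements with `Re tr`
  close to `n` have all eigenvalues close to `1`, and since the `n`-th roots of unity are isolated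
  (`exists_ball_rootsOfUnity`) such an element `≠ 1` of `N` has two distinct eigenvalues
  `d_k ≠ d_l` close to each other; its commutator with `sSwap k l` is
  `dPairHom k l (d_k d̄_l) ∈ N` (`diag_mul_sSwap_conj_inv`).  So the closed subgroup
  `{θ : ℝ | dPairHom i j (e^{iθ}) ∈ N}` is not discrete, hence dense
  (`AddSubgroup.dense_of_not_isolated_zero`), hence `ℝ`; thus all circles lie in `N`, so the
  torus does, so `N = ⊤` (this is the concrete form of BtD IV (2.9)/(3.1) for `SU(n)`).
-/

noncomputable section

open Matrix Complex WithLp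

namespace Literature.MathematicalPhysics.QuantumLattice

variable {n : Type*} [DecidableEq n]

/-! ### The functions `pairFun k l w = (…, w, …, w⁻¹, …)` -/

/-- The function `n → ℂ` with value `w` at `k`, `w⁻¹` at `l` and `1` elsewhere (for `k = l` it
is `1` when `w ≠ 0`). [folklore] -/
def pairFun (k l : n) (w : ℂ) : n → ℂ := Pi.mulSingle k w * Pi.mulSingle l w⁻¹

/-- `pairFun k l 1 = 1`. [folklore] -/
@[simp] theorem pairFun_one (k l : n) : pairFun k l (1 : ℂ) = 1 := by
  simp [pairFun]

/-- `pairFun k l` is multiplicative. [folklore] -/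
theorem pairFun_mul (k l : n) (w w' : ℂ) : pairFun k l (w * w') = pairFun k l w * pairFun k l w' := by
  simp only [pairFun, mul_inv, Pi.mulSingle_mul]
  ring

/-- The entries of `pairFun k l w`, `w ∈ S¹`, have norm one. [folklore] -/
theorem norm_pairFun (k l : n) (w : Circle) (i : n) : ‖pairFun k l (w : ℂ) i‖ = 1 := by
  simp only [pairFun, Pi.mul_apply, Pi.mulSingle_apply]
  split_ifs <;> simp

/-- Precomposing `pairFun k l w` with a transposition moves the two distinguished indices.
[folklore] -/
theorem pairFun_comp_swap (a b k l : n) (w : ℂ) :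
    pairFun k l w ∘ Equiv.swap a b = pairFun (Equiv.swap a b k) (Equiv.swap a b l) w := by
  funext i
  simp only [pairFun, Function.comp_apply, Pi.mul_apply, Pi.mulSingle_apply,
    Equiv.apply_eq_iff_eq_symm_apply, Equiv.symm_swap]

/-! ### Scalars of norm one -/

/-- A complex number of norm one as an element of the circle group `Circle`. [folklore] -/
def circleOfNormEqOne (z : ℂ) (hz : ‖z‖ = 1) : Circle := ⟨z, mem_sphere_zero_iff_norm.2 hz⟩

/-- The underlying complex number of `circleOfNormEqOne z hz` is `z`. [folklore] -/
@[simp] theorem coe_circleOfNormEqOne (z : ℂ) (hz : ‖z‖ = 1) :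
    (circleOfNormEqOne z hz : ℂ) = z := rfl

/-- `z⁻¹ = z̄` on the unit circle. [folklore] -/
theorem inv_eq_conj_of_norm_eq_one {z : ℂ} (hz : ‖z‖ = 1) : z⁻¹ = (starRingEnd ℂ) z := by
  rw [Complex.inv_def, Complex.normSq_eq_norm_sq, hz]; simp

/-- `z z̄ = 1` on the unit circle. [folklore] -/
theorem mul_conj_of_norm_eq_one {z : ℂ} (hz : ‖z‖ = 1) : z * (starRingEnd ℂ) z = 1 := by
  rw [Complex.mul_conj, Complex.normSq_eq_norm_sq, hz]; simp

/-- `‖z w̄‖ = 1` for `z, w` on the unit circle. [folklore] -/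
theorem norm_mul_conj_eq_one {z w : ℂ} (hz : ‖z‖ = 1) (hw : ‖w‖ = 1) :
    ‖z * (starRingEnd ℂ) w‖ = 1 := by
  rw [norm_mul, Complex.norm_conj, hz, hw, mul_one]

/-- `Re z ≤ 1` on the unit circle. [folklore] -/
theorem re_le_one_of_norm_eq_one {z : ℂ} (hz : ‖z‖ = 1) : z.re ≤ 1 :=
  hz ▸ Complex.re_le_norm z

/-- `‖z - 1‖² = 2 - 2 Re z` on the unit circle. [folklore] -/
theorem norm_sub_one_sq {z : ℂ} (hz : ‖z‖ = 1) : ‖z - 1‖ ^ 2 = 2 - 2 * z.re := by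
  have h := Complex.sq_norm z
  rw [hz, Complex.normSq_apply] at h
  rw [Complex.sq_norm, Complex.normSq_apply]
  simp only [Complex.sub_re, Complex.one_re, Complex.sub_im, Complex.one_im]
  nlinarith

/-- A point of the unit circle with real part `1` is `1`. [folklore] -/
theorem eq_one_of_norm_eq_one_of_re {z : ℂ} (hz : ‖z‖ = 1) (h : z.re = 1) : z = 1 := by
  have := norm_sub_one_sq hz
  rw [h] at this
  have h0 : ‖z - 1‖ = 0 := by nlinarith [norm_nonneg (z - 1)]
  exact sub_eq_zero.1 (norm_eq_zero.1 h0)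

/-- The `N`-th roots of unity are isolated at `1`: there is `ε > 0` such that the only `N`-th root
of unity within `ε` of `1` is `1` (they form a finite set). [folklore] -/
theorem exists_ball_rootsOfUnity (N : ℕ) (hN : 0 < N) :
    ∃ ε > 0, ∀ z : ℂ, z ^ N = 1 → ‖z - 1‖ < ε → z = 1 := by
  let S : Set ℂ := {z : ℂ | z ^ N = 1 ∧ z ≠ 1}
  have hSfin : S.Finite := by
    refine Set.Finite.subset (Polynomial.nthRoots N (1 : ℂ)).toFinset.finite_toSet ?_
    intro z hz
    simp only [Finset.mem_coe, Multiset.mem_toFinset, Polynomial.mem_nthRoots hN]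
    exact hz.1
  have h1S : (1 : ℂ) ∈ Sᶜ := fun h => h.2 rfl
  obtain ⟨ε, hε, hball⟩ := Metric.isOpen_iff.1 hSfin.isClosed.isOpen_compl 1 h1S
  refine ⟨ε, hε, fun z hz hzn => ?_⟩
  by_contra hne
  have hzb : z ∈ Metric.ball (1 : ℂ) ε := by rwa [Metric.mem_ball, dist_eq_norm]
  exact hball hzb ⟨hz, hne⟩

variable [Fintype n]

local notation "SU" => Matrix.specialUnitaryGroup n ℂ

/-! ### Unitary diagonalisation of normal matrices; diagonal elements of `SU(n)` -/

/-- **Spectral theorem for normal matrices.** A complex matrix commuting with its conjugate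
transpose has an orthonormal basis of eigenvectors: there is a unitary `U` and `d : n → ℂ` with
`A U = U diag(d)`.  Proof: `H = A + Aᴴ` and `K = i(A - Aᴴ)` are commuting Hermitian matrices,
`2A = H - iK`, and a commuting pair of symmetric operators on the finite-dimensional inner product
space `ℂⁿ` has an orthonormal basis of joint eigenvectors
(`LinearMap.IsSymmetric.directSum_isInternal_of_commute`,
`DirectSum.IsInternal.subordinateOrthonormalBasis`).  Specialised to unitary matrices this is
Bröcker–tom Dieck IV (3.1) (with II (1.13)). [cite: BrockerTomDieck1985, IV (3.1)] -/
theorem exists_unitaryGroup_diagonal_of_commute (A : Matrix n n ℂ)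
    (hA : A * Aᴴ = Aᴴ * A) :
    ∃ (U : Matrix n n ℂ) (_ : U ∈ Matrix.unitaryGroup n ℂ) (d : n → ℂ),
      A * U = U * diagonal d := by
  classical
  -- the Hermitian and (i times the) anti-Hermitian parts
  set H : Matrix n n ℂ := A + Aᴴ with hH
  set K : Matrix n n ℂ := I • (A - Aᴴ) with hK
  have hHh : H.IsHermitian := by
    simp only [hH, IsHermitian, conjTranspose_add, conjTranspose_conjTranspose, add_comm]
  have hKh : K.IsHermitian := by
    simp only [hK, IsHermitian, conjTranspose_smul, conjTranspose_sub,
      conjTranspose_conjTranspose, Complex.star_def, Complex.conj_I, smul_sub, neg_smul]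
    abel
  have hHK : H * K = K * H := by
    simp only [hH, hK, Matrix.mul_smul, Matrix.smul_mul, add_mul, mul_add, mul_sub, sub_mul, hA]
  have h2A : (2 : ℂ) • A = H - I • K := by
    simp only [hH, hK, smul_smul, I_mul_I, smul_sub, neg_smul, one_smul, two_smul]
    abel
  set LH := toEuclideanLin H with hLH
  set LK := toEuclideanLin K with hLK
  have sH : LH.IsSymmetric := isSymmetric_toEuclideanLin_iff.mpr hHh
  have sK : LK.IsSymmetric := isSymmetric_toEuclideanLin_iff.mpr hKh
  have hc : Commute LH LK := by
    change LH * LK = LK * LH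
    simp only [hLH, hLK, Module.End.mul_eq_comp, toEuclideanLin, ← toLpLin_mul_same, hHK]
  set V : ℂ × ℂ → Submodule ℂ (EuclideanSpace ℂ n) := fun i =>
    Module.End.eigenspace LH i.2 ⊓ Module.End.eigenspace LK i.1 with hV
  have hInt : DirectSum.IsInternal V := sH.directSum_isInternal_of_commute sK hc
  have hOF : OrthogonalFamily ℂ (fun i => ↥(V i)) fun i => (V i).subtypeₗᵢ :=
    sH.orthogonalFamily_eigenspace_inf_eigenspace sK
  -- restrict to the finitely many non-trivial joint eigenspaces
  haveI : Fintype {i // V i ≠ ⊥} := hInt.submodule_iSupIndep.fintypeNeBotOfFiniteDimensional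
  have hInt' : DirectSum.IsInternal (fun i : {i // V i ≠ ⊥} => V i) :=
    DirectSum.isInternal_ne_bot_iff.mpr hInt
  have hOF' : OrthogonalFamily ℂ (fun i : {i // V i ≠ ⊥} => ↥(V i)) fun i => (V i).subtypeₗᵢ :=
    hOF.comp Subtype.val_injective
  have hn : Module.finrank ℂ (EuclideanSpace ℂ n) = Fintype.card n := finrank_euclideanSpace
  set b := hInt'.subordinateOrthonormalBasis hn hOF' with hb_def
  set idx : Fin (Fintype.card n) → ℂ × ℂ := fun a =>
    (hInt'.subordinateOrthonormalBasisIndex hn a hOF').1 with hidx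
  have hb : ∀ a, b a ∈ V (idx a) :=
    fun a => hInt'.subordinateOrthonormalBasis_subordinate hn a hOF'
  set e : Fin (Fintype.card n) ≃ n := Fintype.equivOfCardEq (Fintype.card_fin _) with he
  set b' := b.reindex e with hb'
  set d : n → ℂ := fun j => ((idx (e.symm j)).2 - I * (idx (e.symm j)).1) / 2 with hd
  -- eigenvector equation `A b'_j = d_j b'_j`
  have key : ∀ j : n, A *ᵥ (⇑(b' j)) = d j • ⇑(b' j) := by
    intro j
    have hj : b' j = b (e.symm j) := by simp [hb', OrthonormalBasis.reindex_apply]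
    obtain ⟨h1, h2⟩ := Submodule.mem_inf.mp (hb (e.symm j))
    rw [Module.End.mem_eigenspace_iff] at h1 h2
    have h1' : H *ᵥ ⇑(b' j) = (idx (e.symm j)).2 • ⇑(b' j) := by
      have := congrArg ofLp h1
      simpa [hLH, toLpLin_apply, hj] using this
    have h2' : K *ᵥ ⇑(b' j) = (idx (e.symm j)).1 • ⇑(b' j) := by
      have := congrArg ofLp h2
      simpa [hLK, toLpLin_apply, hj] using this
    have hA' : A = (2 : ℂ)⁻¹ • (H - I • K) := by
      rw [← h2A, smul_smul]; norm_num
    rw [hA', Matrix.smul_mulVec, Matrix.sub_mulVec, Matrix.smul_mulVec, h1', h2',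
      smul_smul, ← sub_smul, smul_smul, hd]
    congr 1
    ring
  refine ⟨(EuclideanSpace.basisFun n ℂ).toBasis.toMatrix ⇑b',
    (EuclideanSpace.basisFun n ℂ).toMatrix_orthonormalBasis_mem_unitary b', d, ?_⟩
  ext i j
  have hcol : ∀ k, (EuclideanSpace.basisFun n ℂ).toBasis.toMatrix (⇑b') k j = (⇑(b' j)) k :=
    fun k => rfl
  rw [mul_diagonal, Matrix.mul_apply]
  simp only [hcol]
  have := congrFun (key j) i
  simpa [Matrix.mulVec, dotProduct, mul_comm] using this

/-- A diagonal matrix is unitary iff all its entries have norm one. [folklore] -/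
theorem diagonal_mem_unitaryGroup_iff (d : n → ℂ) :
    diagonal d ∈ Matrix.unitaryGroup n ℂ ↔ ∀ i, ‖d i‖ = 1 := by
  rw [Matrix.mem_unitaryGroup_iff, star_eq_conjTranspose, diagonal_conjTranspose,
    diagonal_mul_diagonal, ← diagonal_one, diagonal_eq_diagonal_iff]
  refine forall_congr' fun i => ?_
  rw [Pi.star_apply, Complex.star_def, Complex.mul_conj, ← Complex.ofReal_one,
    Complex.ofReal_inj, Complex.normSq_eq_norm_sq, pow_eq_one_iff_of_nonneg (norm_nonneg _) two_ne_zero]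

/-- A diagonal matrix lies in `SU(n)` iff all its entries have norm one and their product is
one (the diagonal maximal torus `SΔ(n)`, Bröcker–tom Dieck IV (3.1)).
[cite: BrockerTomDieck1985, IV (3.1)] -/
theorem diagonal_mem_specialUnitaryGroup_iff (d : n → ℂ) :
    diagonal d ∈ SU ↔ (∀ i, ‖d i‖ = 1) ∧ ∏ i, d i = 1 := by
  rw [Matrix.mem_specialUnitaryGroup_iff, diagonal_mem_unitaryGroup_iff, det_diagonal]

/-- Entries of a diagonal element of `SU(n)` have norm one. [folklore] -/
theorem norm_eq_one_of_coe_eq_diagonal {D : SU} {d : n → ℂ} (hD : (D : Matrix n n ℂ) = diagonal d)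
    (i : n) : ‖d i‖ = 1 :=
  ((diagonal_mem_specialUnitaryGroup_iff d).1 (hD ▸ D.2)).1 i

/-- Entries of a diagonal element of `SU(n)` multiply to one. [folklore] -/
theorem prod_eq_one_of_coe_eq_diagonal {D : SU} {d : n → ℂ} (hD : (D : Matrix n n ℂ) = diagonal d) :
    ∏ i, d i = 1 :=
  ((diagonal_mem_specialUnitaryGroup_iff d).1 (hD ▸ D.2)).2

/-- In `SU(n)` the inverse is the conjugate transpose. [folklore] -/
theorem coe_inv_eq_star (x : SU) : ((x⁻¹ : SU) : Matrix n n ℂ) = star (x : Matrix n n ℂ) := rfl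

/-- **Conjugation into the diagonal torus** (Bröcker–tom Dieck IV (1.6), IV (3.1)): every element
of `SU(n)` is `u D u⁻¹` with `u ∈ SU(n)` and `D ∈ SU(n)` diagonal.  From
`exists_unitaryGroup_diagonal_of_commute`, correcting the determinant of the unitary by a
diagonal factor. [cite: BrockerTomDieck1985, IV (3.1)] -/
theorem exists_conj_eq_diagonal [Nonempty n] (x : SU) :
    ∃ (u D : SU) (d : n → ℂ), (D : Matrix n n ℂ) = diagonal d ∧ x = u * D * u⁻¹ := by
  obtain ⟨U, hU, d, hAU⟩ := exists_unitaryGroup_diagonal_of_commute (x : Matrix n n ℂ) (by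
    rw [← star_eq_conjTranspose, Unitary.mul_star_self_of_mem x.2.1,
      Unitary.star_mul_self_of_mem x.2.1])
  obtain ⟨i₀⟩ := ‹Nonempty n›
  set c : ℂ := U.det with hc
  have hc1 : ‖c‖ = 1 := CStarRing.norm_of_mem_unitary (det_of_mem_unitary hU)
  have hcc : c * (starRingEnd ℂ) c = 1 := mul_conj_of_norm_eq_one hc1
  set s : n → ℂ := Function.update 1 i₀ ((starRingEnd ℂ) c) with hs
  have hs1 : ∀ i, ‖s i‖ = 1 := by
    intro i
    by_cases hi : i = i₀
    · subst hi; simp [hs, hc1]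
    · simp [hs, hi]
  have hS : diagonal s ∈ Matrix.unitaryGroup n ℂ := (diagonal_mem_unitaryGroup_iff s).2 hs1
  have hdetS : (diagonal s).det = (starRingEnd ℂ) c := by
    rw [det_diagonal, hs, Finset.prod_update_of_mem (Finset.mem_univ _)]
    simp
  set U' : Matrix n n ℂ := U * diagonal s with hU'
  have hU'mem : U' ∈ SU := by
    refine ⟨Submonoid.mul_mem _ hU hS, ?_⟩
    change (U * diagonal s).det = 1
    rw [det_mul, hdetS, ← hc, hcc]
  have hAU' : (x : Matrix n n ℂ) * U' = U' * diagonal d := by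
    rw [hU', ← mul_assoc, hAU, mul_assoc, mul_assoc, diagonal_mul_diagonal, diagonal_mul_diagonal]
    simp_rw [mul_comm (d _) (s _)]
  set u : SU := ⟨U', hU'mem⟩ with hu
  refine ⟨u, u⁻¹ * x * u, d, ?_, by group⟩
  change star U' * (x : Matrix n n ℂ) * U' = diagonal d
  rw [mul_assoc, hAU', ← mul_assoc, Unitary.star_mul_self_of_mem hU'mem.1, one_mul]

/-! ### The circles `dPairHom k l : S¹ → SU(n)` -/

/-- `∏ᵢ pairFun k l w i = 1` for `w ≠ 0`. [folklore] -/
theorem prod_pairFun (k l : n) (w : ℂ) (hw : w ≠ 0) : ∏ i, pairFun k l w i = 1 := by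
  simp only [pairFun, Pi.mul_apply]
  rw [Finset.prod_mul_distrib, Finset.prod_pi_mulSingle', Finset.prod_pi_mulSingle']
  simp [hw]

/-- `diag(pairFun k l w) ∈ SU(n)` for `w ∈ S¹`. [folklore] -/
theorem diagonal_pairFun_mem (k l : n) (w : Circle) : diagonal (pairFun k l (w : ℂ)) ∈ SU := by
  rw [diagonal_mem_specialUnitaryGroup_iff]
  exact ⟨norm_pairFun k l w, prod_pairFun k l (w : ℂ) (Circle.coe_ne_zero w)⟩

/-- The one-parameter subgroup `S¹ → SU(n)`, `w ↦ diag(…, w, …, w⁻¹, …)` (`w` at `k`, `w⁻¹` at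
`l`); for `k ≠ l` these circles generate the diagonal maximal torus `SΔ(n)`
(Bröcker–tom Dieck IV (3.1)). [cite: BrockerTomDieck1985, IV (3.1)] -/
def dPairHom (k l : n) : Circle →* SU where
  toFun w := ⟨diagonal (pairFun k l (w : ℂ)), diagonal_pairFun_mem k l w⟩
  map_one' := Subtype.ext (by simp)
  map_mul' w w' := Subtype.ext (by
    change diagonal (pairFun k l ((w : ℂ) * w')) = diagonal _ * diagonal _
    rw [pairFun_mul, diagonal_mul_diagonal]
    rfl)

/-- The matrix of `dPairHom k l w` is `diag(pairFun k l w)`. [folklore] -/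
@[simp] theorem coe_dPairHom (k l : n) (w : Circle) :
    ((dPairHom k l w : SU) : Matrix n n ℂ) = diagonal (pairFun k l (w : ℂ)) := rfl

/-- `dPairHom k l` is continuous. [folklore] -/
theorem continuous_dPairHom (k l : n) : Continuous (dPairHom k l : Circle → SU) := by
  refine Continuous.subtype_mk ?_ _
  change Continuous fun w : Circle => diagonal (pairFun k l (w : ℂ))
  refine Continuous.matrix_diagonal ?_
  refine continuous_pi fun i => ?_
  simp only [pairFun, Pi.mul_apply, Pi.mulSingle_apply]
  have hc : Continuous fun w : Circle => (w : ℂ) := continuous_subtype_val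
  have hci : Continuous fun w : Circle => (w : ℂ)⁻¹ := by
    have : Continuous fun w : Circle => ((w⁻¹ : Circle) : ℂ) :=
      continuous_subtype_val.comp (continuous_inv (G := Circle))
    simpa only [Circle.coe_inv] using this
  split_ifs <;> fun_prop

/-! ### Signed transpositions (Weyl group representatives in `SU(n)`) -/

/-- The sign-corrected transposition matrix `diag(…, -1 (at a), …) · swap a b` for `a ≠ b`
(determinant `(-1)·(-1) = 1`), and `1` for `a = b`: a representative in `SU(n)` of the
transposition `(a b)` of the Weyl group `S(n)` (Bröcker–tom Dieck IV (3.3)).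
[cite: BrockerTomDieck1985, IV (3.3)] -/
def sSwapMatrix (a b : n) : Matrix n n ℂ :=
  if a = b then 1 else diagonal (Function.update 1 a (-1)) * Matrix.swap ℂ a b

/-- `sSwapMatrix a b ∈ SU(n)`. [folklore] -/
theorem sSwapMatrix_mem (a b : n) : sSwapMatrix a b ∈ SU := by
  unfold sSwapMatrix
  split_ifs with hab
  · exact Submonoid.one_mem _
  have hd : diagonal (Function.update (1 : n → ℂ) a (-1)) ∈ Matrix.unitaryGroup n ℂ := by
    rw [diagonal_mem_unitaryGroup_iff]
    intro i
    by_cases hi : i = a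
    · subst hi; simp
    · simp [hi]
  have hsw : Matrix.swap ℂ a b ∈ Matrix.unitaryGroup n ℂ := by
    rw [Matrix.mem_unitaryGroup_iff, star_eq_conjTranspose, conjTranspose_swap, swap_mul_self]
  refine ⟨Submonoid.mul_mem _ hd hsw, ?_⟩
  change (diagonal (Function.update (1 : n → ℂ) a (-1)) * Matrix.swap ℂ a b).det = 1
  rw [det_mul, det_diagonal, Finset.prod_update_of_mem (Finset.mem_univ _), Matrix.swap,
    det_permutation, Equiv.Perm.sign_swap hab]
  simp

/-- The signed transposition `(a b)` as an element of `SU(n)` (Bröcker–tom Dieck IV (3.3)).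
[cite: BrockerTomDieck1985, IV (3.3)] -/
def sSwap (a b : n) : SU := ⟨sSwapMatrix a b, sSwapMatrix_mem a b⟩

/-- The matrix of `sSwap a b`. [folklore] -/
@[simp] theorem coe_sSwap (a b : n) : ((sSwap a b : SU) : Matrix n n ℂ) = sSwapMatrix a b := rfl

/-- Conjugating a diagonal matrix by a signed transposition permutes the diagonal entries (the
Weyl group of `SU(n)` acts on the torus by permutations, Bröcker–tom Dieck IV (3.2)–(3.3)).
[cite: BrockerTomDieck1985, IV (3.3)] -/
theorem sSwapMatrix_mul_diagonal_mul_star (a b : n) (d : n → ℂ) :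
    sSwapMatrix a b * diagonal d * star (sSwapMatrix a b) = diagonal (d ∘ Equiv.swap a b) := by
  unfold sSwapMatrix
  split_ifs with hab
  · subst hab; simp [Equiv.swap_self]
  set s : n → ℂ := Function.update 1 a (-1) with hs
  have hss : ∀ i, s i * s i = 1 := by
    intro i; by_cases hi : i = a
    · subst hi; simp [hs]
    · simp [hs, hi]
  rw [star_eq_conjTranspose, conjTranspose_mul, conjTranspose_swap, diagonal_conjTranspose]
  have hstar : star s = s := by
    funext i; by_cases hi : i = a
    · subst hi; simp [hs]
    · simp [hs, hi]
  rw [hstar]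
  have hP : Matrix.swap ℂ a b * diagonal d * Matrix.swap ℂ a b = diagonal (d ∘ Equiv.swap a b) := by
    rw [Matrix.swap, Equiv.Perm.permMatrix, PEquiv.toMatrix_toPEquiv_mul,
      PEquiv.mul_toMatrix_toPEquiv, Equiv.symm_swap, submatrix_submatrix]
    simp [submatrix_diagonal_equiv]
  calc diagonal s * Matrix.swap ℂ a b * diagonal d * (Matrix.swap ℂ a b * diagonal s)
      = diagonal s * (Matrix.swap ℂ a b * diagonal d * Matrix.swap ℂ a b) * diagonal s := by
        simp only [mul_assoc]
    _ = diagonal (d ∘ Equiv.swap a b) := by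
        rw [hP, diagonal_mul_diagonal, diagonal_mul_diagonal]
        congr 1
        funext i
        rw [mul_comm (s i), mul_assoc, hss i, mul_one]

/-- Matrix form of `sSwap a b * D * (sSwap a b)⁻¹` for diagonal `D ∈ SU(n)`. [folklore] -/
theorem coe_sSwap_conj {D : SU} {d : n → ℂ} (hD : (D : Matrix n n ℂ) = diagonal d) (a b : n) :
    ((sSwap a b * D * (sSwap a b)⁻¹ : SU) : Matrix n n ℂ) = diagonal (d ∘ Equiv.swap a b) := by
  change sSwapMatrix a b * (D : Matrix n n ℂ) * star (sSwapMatrix a b) = _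
  rw [hD, sSwapMatrix_mul_diagonal_mul_star]

/-- Conjugation by `sSwap a b` moves the circle `dPairHom k l` to `dPairHom (σ k) (σ l)`,
`σ = (a b)`. [folklore] -/
theorem sSwap_conj_dPairHom (a b k l : n) (w : Circle) :
    sSwap a b * dPairHom k l w * (sSwap a b)⁻¹ = dPairHom (Equiv.swap a b k) (Equiv.swap a b l) w :=
  Subtype.ext (by rw [coe_sSwap_conj (coe_dPairHom k l w), coe_dPairHom, pairFun_comp_swap])

/-- **Commutator formula.** For a diagonal `D = diag(d) ∈ SU(n)` and `k ≠ l`, the commutator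
`D · (s D⁻¹ s⁻¹)` with the signed transposition `s = sSwap k l` is the circle element
`dPairHom k l (d_k d̄_l) = diag(…, d_k/d_l, …, d_l/d_k, …)`. [folklore] -/
theorem diag_mul_sSwap_conj_inv {D : SU} {d : n → ℂ} (hD : (D : Matrix n n ℂ) = diagonal d)
    {k l : n} (hkl : k ≠ l) :
    D * (sSwap k l * D⁻¹ * (sSwap k l)⁻¹) =
      dPairHom k l (circleOfNormEqOne (d k * (starRingEnd ℂ) (d l))
        (norm_mul_conj_eq_one (norm_eq_one_of_coe_eq_diagonal hD k)
          (norm_eq_one_of_coe_eq_diagonal hD l))) := by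
  have hd1 := norm_eq_one_of_coe_eq_diagonal hD
  have hDinv : ((D⁻¹ : SU) : Matrix n n ℂ) = diagonal (star d) := by
    rw [coe_inv_eq_star, hD, star_eq_conjTranspose, diagonal_conjTranspose]
  apply Subtype.ext
  change (D : Matrix n n ℂ) * ((sSwap k l * D⁻¹ * (sSwap k l)⁻¹ : SU) : Matrix n n ℂ) = _
  rw [coe_sSwap_conj hDinv, hD, diagonal_mul_diagonal, coe_dPairHom]
  congr 1
  funext i
  simp only [Function.comp_apply, Pi.star_apply, Complex.star_def, pairFun, Pi.mul_apply,
    Pi.mulSingle_apply, coe_circleOfNormEqOne, Equiv.swap_apply_def]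
  by_cases hik : i = k
  · subst hik
    simp [hkl]
  · by_cases hil : i = l
    · subst hil
      simp only [hik, if_false, if_true, one_mul, mul_inv]
      rw [inv_eq_conj_of_norm_eq_one (hd1 k), ← map_inv₀, inv_eq_conj_of_norm_eq_one (hd1 i),
        Complex.conj_conj, mul_comm]
    · simp only [hik, hil, if_false, mul_one]
      exact mul_conj_of_norm_eq_one (hd1 i)

/-- **The circles generate the torus.** A subgroup of `SU(n)` containing all circle elements
`dPairHom k k₀ w` (`k ≠ k₀`) contains every diagonal element of `SU(n)`: by induction, peeling off
one diagonal entry at a time (Bröcker–tom Dieck IV (3.1): `SΔ(n) ≅ (S¹)ⁿ⁻¹`).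
[cite: BrockerTomDieck1985, IV (3.1)] -/
theorem diag_mem_of_dPairHom_mem (M : Subgroup SU) (k₀ : n)
    (hM : ∀ k, k ≠ k₀ → ∀ w, dPairHom k k₀ w ∈ M) :
    ∀ (D : SU) (d : n → ℂ), (D : Matrix n n ℂ) = diagonal d → D ∈ M := by
  -- induction on a finset `s` outside of which (and of `k₀`) the entries of `d` equal `1`
  suffices h : ∀ (s : Finset n) (D : SU) (d : n → ℂ), (D : Matrix n n ℂ) = diagonal d →
      (∀ k, k ∉ s → k ≠ k₀ → d k = 1) → D ∈ M by
    intro D d hD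
    exact h Finset.univ D d hD (fun k hk => absurd (Finset.mem_univ k) hk)
  intro s
  induction s using Finset.induction_on with
  | empty =>
    intro D d hD hd
    have hd' : ∀ k, k ≠ k₀ → d k = 1 := fun k hk => hd k (Finset.notMem_empty k) hk
    have hk₀ : d k₀ = 1 := by
      have hprod := prod_eq_one_of_coe_eq_diagonal hD
      rw [← Finset.mul_prod_erase Finset.univ d (Finset.mem_univ k₀),
        Finset.prod_eq_one (fun k hk => hd' k (Finset.ne_of_mem_erase hk)), mul_one] at hprod
      exact hprod
    have hd1 : d = 1 := by
      funext k
      by_cases hk : k = k₀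
      · subst hk; exact hk₀
      · exact hd' k hk
    have : D = 1 := Subtype.ext (by rw [hD, hd1]; exact diagonal_one)
    rw [this]
    exact M.one_mem
  | insert a s has ih =>
    intro D d hD hd
    by_cases hak : a = k₀
    · refine ih D d hD fun k hk hkk => hd k ?_ hkk
      subst hak
      exact fun h => by
        rcases Finset.mem_insert.1 h with h | h
        · exact hkk h
        · exact hk h
    -- peel off the entry at `a`
    have hd1 := norm_eq_one_of_coe_eq_diagonal hD
    let w : Circle := circleOfNormEqOne (d a) (hd1 a)
    have hw : (w : ℂ) = d a := rfl
    have hcoe : (((dPairHom a k₀ w)⁻¹ * D : SU) : Matrix n n ℂ) =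
        diagonal (star (pairFun a k₀ (d a)) * d) := by
      change star ((dPairHom a k₀ w : SU) : Matrix n n ℂ) * (D : Matrix n n ℂ) = _
      rw [coe_dPairHom, hw, hD, star_eq_conjTranspose, diagonal_conjTranspose, diagonal_mul_diagonal]
      rfl
    have hmem' : (dPairHom a k₀ w)⁻¹ * D ∈ M := by
      refine ih _ _ hcoe ?_
      intro k hk hkk
      simp only [Pi.mul_apply, Pi.star_apply, pairFun, Pi.mulSingle_apply, Complex.star_def]
      by_cases hka : k = a
      · subst hka
        simp only [if_true, hkk, if_false, mul_one]
        rw [mul_comm]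
        exact mul_conj_of_norm_eq_one (hd1 k)
      · have hks : k ∉ insert a s := fun h => by
          rcases Finset.mem_insert.1 h with h | h
          · exact hka h
          · exact hk h
        simp [hka, hkk, hd k hks hkk]
    have : D = dPairHom a k₀ w * ((dPairHom a k₀ w)⁻¹ * D) := by group
    rw [this]
    exact M.mul_mem (hM a hak w) hmem'

/-- A conjugation-invariant subgroup of `SU(n)` containing the diagonal elements is everything,
because every element is conjugate to a diagonal one (Bröcker–tom Dieck IV (1.6), (3.1)).
[cite: BrockerTomDieck1985, IV (1.6)] -/
theorem eq_top_of_diag_mem [Nonempty n] (M : Subgroup SU)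
    (hdiag : ∀ (D : SU) (d : n → ℂ), (D : Matrix n n ℂ) = diagonal d → D ∈ M)
    (hconj : ∀ u D : SU, D ∈ M → u * D * u⁻¹ ∈ M) : M = ⊤ := by
  rw [eq_top_iff]
  intro x _
  obtain ⟨u, D, d, hD, rfl⟩ := exists_conj_eq_diagonal x
  exact hconj u D (hdiag D d hD)

/-! ### Connectedness and non-commutativity of `SU(n)` -/

/-- `SU(n)` is connected (Bröcker–tom Dieck I (1.8), IV (3.1); Sepanski §1.2.1): the connected
component of `1` is a conjugation-invariant subgroup containing the (connected) circles
`dPairHom k l`, hence the diagonal torus, hence everything. [cite: BrockerTomDieck1985, IV (3.1)] -/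
theorem connectedSpace_specialUnitaryGroup [Nonempty n] : ConnectedSpace SU := by
  let M := Subgroup.connectedComponentOfOne SU
  have hM : ∀ k l (w : Circle), dPairHom k l w ∈ M := by
    intro k l w
    have h := (isConnected_range (continuous_dPairHom k l)).isPreconnected.subset_connectedComponent
      (show (1 : SU) ∈ Set.range (dPairHom k l) from ⟨1, map_one _⟩)
    exact h ⟨w, rfl⟩
  have hconj : ∀ u D : SU, D ∈ M → u * D * u⁻¹ ∈ M := by
    intro u D hD
    have hc : Continuous fun g : SU => u * g * u⁻¹ := by fun_prop
    have h1 : (1 : SU) ∈ (fun g : SU => u * g * u⁻¹) '' connectedComponent (1 : SU) :=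
      ⟨1, mem_connectedComponent, by simp⟩
    have := (isPreconnected_connectedComponent.image _ hc.continuousOn).subset_connectedComponent h1
    exact this ⟨D, hD, rfl⟩
  obtain ⟨k₀⟩ := ‹Nonempty n›
  have htop : M = ⊤ :=
    eq_top_of_diag_mem M (diag_mem_of_dPairHom_mem M k₀ fun k _ w => hM k k₀ w) hconj
  have huniv : connectedComponent (1 : SU) = Set.univ := by
    have := congrArg (fun H : Subgroup SU => (H : Set SU)) htop
    simpa [M, Subgroup.connectedComponentOfOne] using this
  exact { isPreconnected_univ := huniv ▸ isPreconnected_connectedComponent, toNonempty := ⟨1⟩ }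

/-- `SU(n)` is non-abelian for `n ≥ 2`: the signed transposition `(i j)` does not commute with
`diag(i, -i, 1, …)` (it conjugates it to `diag(-i, i, 1, …)`). [folklore] -/
theorem exists_mul_ne_mul (hn : 2 ≤ Fintype.card n) : ∃ a b : SU, a * b ≠ b * a := by
  obtain ⟨i, j, hij⟩ := Fintype.exists_pair_of_one_lt_card hn
  let w : Circle := circleOfNormEqOne Complex.I (by simp)
  have hw : (w : ℂ) = Complex.I := rfl
  refine ⟨sSwap i j, dPairHom i j w, fun h => ?_⟩
  have h1 : sSwap i j * dPairHom i j w * (sSwap i j)⁻¹ = dPairHom i j w := by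
    rw [h, mul_inv_cancel_right]
  rw [sSwap_conj_dPairHom, Equiv.swap_apply_left, Equiv.swap_apply_right] at h1
  have h2 := congrArg (fun x : SU => (x : Matrix n n ℂ) i i) h1
  simp only [coe_dPairHom, diagonal_apply_eq, pairFun, Pi.mul_apply, Pi.mulSingle_apply, hij,
    if_false, if_true, one_mul, mul_one, hw, Complex.inv_I] at h2
  have := congrArg Complex.im h2
  norm_num at this

/-! ### The class function `Re tr` -/

/-- The class function `x ↦ Re tr x` on `SU(n)` (real part of the character of the fundamental
representation). [folklore] -/
def reTr (x : SU) : ℝ := (Matrix.trace (x : Matrix n n ℂ)).re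

/-- `Re tr` is continuous. [folklore] -/
theorem continuous_reTr : Continuous (reTr : SU → ℝ) := by
  unfold reTr
  fun_prop

/-- `Re tr 1 = n`. [folklore] -/
theorem reTr_one : reTr (1 : SU) = Fintype.card n := by
  simp [reTr]

/-- `Re tr` is a class function. [folklore] -/
theorem reTr_conj (u D : SU) : reTr (u * D * u⁻¹) = reTr D := by
  unfold reTr
  change (Matrix.trace ((u : Matrix n n ℂ) * (D : Matrix n n ℂ) * star (u : Matrix n n ℂ))).re = _
  rw [Matrix.trace_mul_cycle, Unitary.star_mul_self_of_mem u.2.1, one_mul]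

/-- `Re tr diag(d) = ∑ Re dᵢ`. [folklore] -/
theorem reTr_eq_sum {D : SU} {d : n → ℂ} (hD : (D : Matrix n n ℂ) = diagonal d) :
    reTr D = ∑ i, (d i).re := by
  simp [reTr, hD, trace_diagonal, Complex.re_sum]

/-- `Re tr x ≤ n` on `SU(n)` (all eigenvalues lie on the unit circle). [folklore] -/
theorem reTr_le [Nonempty n] (x : SU) : reTr x ≤ Fintype.card n := by
  obtain ⟨u, D, d, hD, rfl⟩ := exists_conj_eq_diagonal x
  rw [reTr_conj, reTr_eq_sum hD]
  calc ∑ i, (d i).re ≤ ∑ _i : n, (1 : ℝ) :=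
        Finset.sum_le_sum fun i _ => re_le_one_of_norm_eq_one (norm_eq_one_of_coe_eq_diagonal hD i)
    _ = Fintype.card n := by simp

/-- `Re tr x = n` only for `x = 1` (all eigenvalues must be `1`). [folklore] -/
theorem eq_one_of_reTr_eq [Nonempty n] (x : SU) (hx : reTr x = Fintype.card n) : x = 1 := by
  obtain ⟨u, D, d, hD, rfl⟩ := exists_conj_eq_diagonal x
  rw [reTr_conj, reTr_eq_sum hD] at hx
  have hd1 := norm_eq_one_of_coe_eq_diagonal hD
  have hall : ∀ i ∈ Finset.univ, (d i).re = 1 :=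
    (Finset.sum_eq_sum_iff_of_le (f := fun i => (d i).re) (g := fun _ => (1 : ℝ))
      (s := Finset.univ) fun i _ => re_le_one_of_norm_eq_one (hd1 i)).1 (by rw [hx]; simp)
  have hd : d = 1 := funext fun i => eq_one_of_norm_eq_one_of_re (hd1 i) (hall i (Finset.mem_univ i))
  have hD1 : D = 1 := Subtype.ext (by rw [hD, hd]; exact diagonal_one)
  rw [hD1, mul_one, mul_inv_cancel]

/-! ### Closed connected normal subgroups of `SU(n)` -/

/-- Transport between index pairs: if a normal subgroup contains the circle element
`dPairHom k l w` for one pair `k ≠ l`, it contains `dPairHom k' l' w` for every pair `k' ≠ l'`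
(conjugate by two signed transpositions; the Weyl group `S(n)` is doubly transitive,
Bröcker–tom Dieck IV (3.3)). [cite: BrockerTomDieck1985, IV (3.3)] -/
theorem dPairHom_mem_of_mem (N : Subgroup SU) [hN : N.Normal] {k l : n} (hkl : k ≠ l) {w : Circle}
    (h : dPairHom k l w ∈ N) {k' l' : n} (hkl' : k' ≠ l') : dPairHom k' l' w ∈ N := by
  have h1 : dPairHom k' (Equiv.swap k k' l) w ∈ N := by
    have := hN.conj_mem _ h (sSwap k k')
    rwa [sSwap_conj_dPairHom, Equiv.swap_apply_left] at this
  have hl₁ : Equiv.swap k k' l ≠ k' := by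
    intro h'
    rw [Equiv.swap_apply_eq_iff, Equiv.swap_apply_right] at h'
    exact hkl h'.symm
  have h2 := hN.conj_mem _ h1 (sSwap (Equiv.swap k k' l) l')
  rwa [sSwap_conj_dPairHom, Equiv.swap_apply_of_ne_of_ne hl₁.symm hkl', Equiv.swap_apply_left]
    at h2

/-- **Closed connected normal subgroups of `SU(n)`, `n ≥ 2`, are `⊥` or `⊤`.**  For a closed
preconnected normal `N ≠ ⊥`: `Re tr` maps `N` onto an interval `[t₀, n]` with `t₀ < n`
(`IsPreconnected.Icc_subset`); an element of `N` with `Re tr` within `δ` of `n` has all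
eigenvalues within `√(2δ)` of `1`, and as the `n`-th roots of unity are isolated
(`exists_ball_rootsOfUnity`) such an element `≠ 1` has two distinct eigenvalues `d_k ≠ d_l`; its
commutator with `sSwap k l` is `dPairHom k l (d_k d̄_l) ∈ N` with `d_k d̄_l ≠ 1` arbitrarily close
to `1`.  Hence the closed subgroup `{θ : ℝ | dPairHom i j (e^{iθ}) ∈ N}` is dense
(`AddSubgroup.dense_of_not_isolated_zero`), so equal to `ℝ`; so `N` contains all circles, hence
the torus (`diag_mem_of_dPairHom_mem`), hence everything (`eq_top_of_diag_mem`).  This is the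
concrete `SU(n)` case of "a proper normal subgroup of a simple compact group is central/finite"
(Bröcker–tom Dieck IV (2.9), V (7.13), V (8.7) Ex. 6). [cite: BrockerTomDieck1985, IV (2.9) and V (8.7) Ex. 6] -/
theorem normal_subgroup_eq_bot_or_eq_top (hn : 2 ≤ Fintype.card n) (N : Subgroup SU) [hN : N.Normal]
    (hclosed : IsClosed (N : Set SU)) (hconn : IsPreconnected (N : Set SU)) : N = ⊥ ∨ N = ⊤ := by
  haveI : Nonempty n := Fintype.card_pos_iff.1 (by omega)
  by_cases hbot : N = ⊥
  · exact Or.inl hbot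
  right
  obtain ⟨i, j, hij⟩ := Fintype.exists_pair_of_one_lt_card hn
  -- a non-identity element of `N`
  obtain ⟨g, hgN, hg1⟩ : ∃ g ∈ N, g ≠ 1 := by
    by_contra h
    push Not at h
    exact hbot ((Subgroup.eq_bot_iff_forall _).2 h)
  set c : ℝ := (Fintype.card n : ℝ) with hc
  have hg : reTr g < c := lt_of_le_of_ne (reTr_le g) (fun h => hg1 (eq_one_of_reTr_eq g h))
  -- the image of `N` under `Re tr` contains the interval `[Re tr g, n]`
  have hIcc : Set.Icc (reTr g) c ⊆ reTr '' (N : Set SU) := by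
    have hpc : IsPreconnected (reTr '' (N : Set SU)) := hconn.image _ continuous_reTr.continuousOn
    exact hpc.Icc_subset ⟨g, hgN, rfl⟩ ⟨1, N.one_mem, reTr_one⟩
  -- roots of unity are isolated
  obtain ⟨ε₀, hε₀, hroot⟩ := exists_ball_rootsOfUnity (Fintype.card n) (by omega)
  -- KEY CLAIM: `N` contains circle elements `diag(w, w⁻¹, 1, …)` with `w ≠ 1` arbitrarily near `1`
  have key : ∀ η > 0, ∃ w : Circle, w ≠ 1 ∧ ‖(w : ℂ) - 1‖ < η ∧ dPairHom i j w ∈ N := by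
    intro η hη
    obtain ⟨δ, hδ0, hδε, hδη⟩ : ∃ δ : ℝ, 0 < δ ∧ 2 * δ ≤ ε₀ ^ 2 ∧ 8 * δ ≤ η ^ 2 :=
      ⟨min (ε₀ ^ 2 / 2) (η ^ 2 / 8), by positivity,
        by nlinarith [min_le_left (ε₀ ^ 2 / 2) (η ^ 2 / 8)],
        by nlinarith [min_le_right (ε₀ ^ 2 / 2) (η ^ 2 / 8)]⟩
    -- a value `t` of `Re tr` on `N` with `c - δ < t < c`
    set t := max (reTr g) (c - δ / 2) with ht
    have htI : t ∈ Set.Icc (reTr g) c := ⟨le_max_left _ _, max_le hg.le (by linarith)⟩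
    have htc : t < c := max_lt hg (by linarith)
    have htδ : c - δ < t := lt_of_lt_of_le (by linarith) (le_max_right _ _)
    obtain ⟨x, hxN, hxt⟩ := hIcc htI
    -- diagonalise `x = u D u⁻¹`; then `D ∈ N`
    obtain ⟨u, D, d, hD, rfl⟩ := exists_conj_eq_diagonal x
    have hDN : D ∈ N := by
      have := hN.conj_mem _ hxN u⁻¹
      rwa [inv_inv, ← mul_assoc, ← mul_assoc, inv_mul_cancel, one_mul, mul_assoc, inv_mul_cancel,
        mul_one] at this
    have hd1 := norm_eq_one_of_coe_eq_diagonal hD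
    rw [reTr_conj, reTr_eq_sum hD] at hxt
    -- all eigenvalues are close to `1`
    have hre : ∀ k, 1 - δ < (d k).re := by
      intro k
      have hsum := Finset.add_sum_erase Finset.univ (fun i => (d i).re) (Finset.mem_univ k)
      have hbound : ∑ i ∈ Finset.univ.erase k, (d i).re ≤ c - 1 := by
        calc ∑ i ∈ Finset.univ.erase k, (d i).re ≤ ∑ _i ∈ Finset.univ.erase k, (1 : ℝ) :=
              Finset.sum_le_sum fun i _ => re_le_one_of_norm_eq_one (hd1 i)
          _ = c - 1 := by
              rw [Finset.sum_const, Finset.card_erase_of_mem (Finset.mem_univ k), Finset.card_univ,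
                nsmul_eq_mul, mul_one, Nat.cast_sub (by omega), Nat.cast_one]
      linarith
    -- some eigenvalue is not `1`
    obtain ⟨k, hk⟩ : ∃ k, (d k).re < 1 := by
      by_contra h
      push Not at h
      have : c ≤ ∑ i, (d i).re := by
        calc c = ∑ _i : n, (1 : ℝ) := by simp [hc]
          _ ≤ _ := Finset.sum_le_sum fun i _ => h i
      linarith
    have hk1 : d k ≠ 1 := fun h => by simp [h] at hk
    -- and not all eigenvalues are equal (else `d k` would be a root of unity close to `1`)
    obtain ⟨l, hl⟩ : ∃ l, d l ≠ d k := by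
      by_contra h
      push Not at h
      have hpow : d k ^ Fintype.card n = 1 := by
        rw [← prod_eq_one_of_coe_eq_diagonal hD, Finset.prod_congr rfl (fun i _ => h i),
          Finset.prod_const, Finset.card_univ]
      have hnorm : ‖d k - 1‖ < ε₀ := by
        have h2 : ‖d k - 1‖ ^ 2 < ε₀ ^ 2 := by rw [norm_sub_one_sq (hd1 k)]; linarith [hre k]
        exact lt_of_pow_lt_pow_left₀ 2 hε₀.le h2
      exact hk1 (hroot _ hpow hnorm)
    have hkl : k ≠ l := fun h => hl (h ▸ rfl)
    refine ⟨circleOfNormEqOne (d k * (starRingEnd ℂ) (d l)) (norm_mul_conj_eq_one (hd1 k) (hd1 l)),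
      ?_, ?_, ?_⟩
    · -- `w ≠ 1`
      intro hw
      have hw' : d k * (starRingEnd ℂ) (d l) = 1 := by
        have := congrArg (fun z : Circle => (z : ℂ)) hw
        simpa using this
      apply hl
      calc d l = d k * (starRingEnd ℂ) (d l) * d l := by rw [hw', one_mul]
        _ = d k := by rw [mul_assoc, mul_comm ((starRingEnd ℂ) (d l)),
            mul_conj_of_norm_eq_one (hd1 l), mul_one]
    · -- `‖w - 1‖ < η`
      change ‖d k * (starRingEnd ℂ) (d l) - 1‖ < η
      have hfac : d k * (starRingEnd ℂ) (d l) - 1 = (d k - d l) * (starRingEnd ℂ) (d l) := by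
        rw [sub_mul, mul_conj_of_norm_eq_one (hd1 l)]
      rw [hfac, norm_mul, Complex.norm_conj, hd1 l, mul_one]
      have h3 : ‖d k - d l‖ ≤ ‖d k - 1‖ + ‖d l - 1‖ := by
        calc ‖d k - d l‖ = ‖(d k - 1) - (d l - 1)‖ := by rw [sub_sub_sub_cancel_right]
          _ ≤ _ := norm_sub_le _ _
      have h4 : ‖d k - 1‖ ^ 2 < 2 * δ := by rw [norm_sub_one_sq (hd1 k)]; linarith [hre k]
      have h5 : ‖d l - 1‖ ^ 2 < 2 * δ := by rw [norm_sub_one_sq (hd1 l)]; linarith [hre l]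
      have h6 : (‖d k - 1‖ + ‖d l - 1‖) ^ 2 < η ^ 2 := by
        nlinarith [norm_nonneg (d k - 1), norm_nonneg (d l - 1),
          sq_nonneg (‖d k - 1‖ - ‖d l - 1‖)]
      have h7 : ‖d k - 1‖ + ‖d l - 1‖ < η := lt_of_pow_lt_pow_left₀ 2 hη.le h6
      linarith
    · -- membership: the commutator of `D` with the signed transposition `(k l)` lies in `N`
      have hmem : D * (sSwap k l * D⁻¹ * (sSwap k l)⁻¹) ∈ N :=
        N.mul_mem hDN (hN.conj_mem _ (N.inv_mem hDN) _)
      rw [diag_mul_sSwap_conj_inv hD hkl] at hmem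
      exact dPairHom_mem_of_mem N hkl hmem hij
  -- the closed subgroup `K = {θ | diag(e^{iθ}, e^{-iθ}, 1, …) ∈ N}` of `ℝ` is not discrete, so `= ℝ`
  let K : AddSubgroup ℝ :=
    { carrier := {θ | dPairHom i j (Circle.exp θ) ∈ N}
      zero_mem' := by
        change dPairHom i j (Circle.exp 0) ∈ N
        rw [Circle.exp_zero, map_one]; exact N.one_mem
      add_mem' := fun {a b} ha hb => by
        change dPairHom i j (Circle.exp (a + b)) ∈ N
        rw [Circle.exp_add, map_mul]; exact N.mul_mem ha hb
      neg_mem' := fun {a} ha => by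
        change dPairHom i j (Circle.exp (-a)) ∈ N
        rw [Circle.exp_neg, map_inv]; exact N.inv_mem ha }
  have hKc : IsClosed (K : Set ℝ) :=
    hclosed.preimage ((continuous_dPairHom i j).comp Circle.exp.continuous)
  have hKd : Dense (K : Set ℝ) := by
    refine AddSubgroup.dense_of_not_isolated_zero K fun ε hε => ?_
    obtain ⟨η, hη, hηε⟩ := Metric.continuousAt_iff.1
      (Complex.continuousAt_arg Complex.one_mem_slitPlane) ε hε
    obtain ⟨w, hw1, hwη, hwN⟩ := key η hη
    have harg : |Complex.arg (w : ℂ)| < ε := by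
      have := hηε (by rwa [dist_eq_norm])
      rwa [Complex.arg_one, Real.dist_eq, sub_zero] at this
    have harg0 : Complex.arg (w : ℂ) ≠ 0 := fun h => hw1 (Circle.arg_eq_zero.1 h)
    have hmem : Complex.arg (w : ℂ) ∈ K := by
      change dPairHom i j (Circle.exp (Complex.arg (w : ℂ))) ∈ N
      rwa [Circle.exp_arg]
    rcases lt_or_gt_of_ne harg0 with hneg | hpos
    · exact ⟨-Complex.arg (w : ℂ), K.neg_mem hmem, by linarith, by linarith [neg_lt_of_abs_lt harg]⟩
    · exact ⟨Complex.arg (w : ℂ), hmem, hpos, lt_of_abs_lt harg⟩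
  have hK : (K : Set ℝ) = Set.univ := by rw [← hKc.closure_eq]; exact hKd.closure_eq
  have hall : ∀ w : Circle, dPairHom i j w ∈ N := fun w => by
    have : Complex.arg (w : ℂ) ∈ (K : Set ℝ) := hK ▸ Set.mem_univ _
    change dPairHom i j (Circle.exp (Complex.arg (w : ℂ))) ∈ N at this
    rwa [Circle.exp_arg] at this
  have hall' : ∀ k, k ≠ j → ∀ w, dPairHom k j w ∈ N := fun k hk w =>
    dPairHom_mem_of_mem N hij (hall w) hk
  exact eq_top_of_diag_mem N (diag_mem_of_dPairHom_mem N j hall') fun u D hD => hN.conj_mem D hD u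

/-! ### The discharge -/

/-- **Discharge of `isSimpleCompactGroup_specialUnitaryGroup`:** for `2 ≤ card n`, `SU(n)` is a
simple compact group in the sense of `IsSimpleCompactGroup` — connected
(`connectedSpace_specialUnitaryGroup`), non-abelian (`exists_mul_ne_mul`), and every closed
connected normal subgroup is `⊥` or `⊤` (`normal_subgroup_eq_bot_or_eq_top`)
(Bröcker–tom Dieck I (1.8), IV (3.1), (3.3), V (7.13), V (8.7) Ex. 6; Sepanski §1.1.4, §1.2.1).
[cite: BrockerTomDieck1985, IV (3.1), IV (3.3) and V (8.7) Ex. 6] [cite: Sepanski2007, §1.1.4 and §1.2.1] -/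
theorem isSimpleCompactGroup_specialUnitaryGroup_holds : isSimpleCompactGroup_specialUnitaryGroup := by
  intro n _ _ hn
  haveI : Nonempty n := Fintype.card_pos_iff.1 (by omega)
  exact ⟨connectedSpace_specialUnitaryGroup, exists_mul_ne_mul hn,
    fun N hN hc hp => normal_subgroup_eq_bot_or_eq_top hn N hc hp⟩

end Literature.MathematicalPhysics.QuantumLattice
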